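import Literature.MathematicalPhysics.QuantumFieldTheory.Balaban1983to89.B9B8AveragingKernelZd
import HarnessLib

/-!
# Route `UnitScaleTilt`, crux K1 «MinimiserStabilityRegPr» (stmt-QuantumFields-19200) — route-R E′ (A′), LANE II «DIVERGENCE RECOVERY AT CURVED `W`» (★★OWNER RULING №23),
# brick (B2a), sub-pen F4 (★p1 g19 NAMER WORD №6 (3)), FILE F4-T: **THE TENSOR TENT WEIGHTS ON `ℤᵈ` AT SPACING `ℓ`** — the partition of unity of the covariant tent quasi-interpolant

Cell `ym3-torus` ∕ width seat `ym3-torus-px3` (gen 6).  THEOREMS ONLY (0 `def`, 0 `sorry`); pure `ℤᵈ`∕`ℝ` bookkeeping (lit `QuantumLattice` block letters);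
`--supports stmt-QuantumFields-19200 --as helper`, count-neutral.  YM₃ on T³ is a ladder rung (R3), not d = 4, not the Clay problem; nothing here claims anything of print.

THE WEIGHTS (written INLINE everywhere, no definition).  One-dimensional tent of half-width `ℓ` centred at `ℓ`: `t(q) := max 0 (1 − |q − ℓ|∕ℓ)` (`q ∈ ℤ` read in `ℝ`), so `t(q) = q∕ℓ` on
`[0, ℓ]`, `t(q) = (2ℓ − q)∕ℓ` on `[ℓ, 2ℓ]`, `0` outside `(0, 2ℓ)`, `ℓ⁻¹`-Lipschitz, values in `[0, 1]`.  Tensor tent of the coarse site `Y′` at the fine site `z`: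
`Θ(Y′, z) := Π_i t(z i − ℓ·Y′ i)` — supported on the `2^d` boxes `Y′ + δ`, `δ ∈ {0,1}^d`, i.e. in the POSITIVE orthant of the corner `ℓY′` (so that the one-shot axial frame rooted at
`ℓY′` is read only at sites `≥` its root, inside lit ✓`B8Lemma1NonAbelian.axial_bond_bound_sharp`'s hypothesis).  Conversely the boxes weighted at a fine site `z` of box `Y` (offset
`r = z − ℓY ∈ [0, ℓ)^d`) are exactly `Y − δ`, `δ ∈ {0,1}^d`, with weights `Π_i (δ i = 0 ? r i∕ℓ : (ℓ − r i)∕ℓ)`; and the SAME eight boxes carry all the weight at `z + e_μ` too (in-box or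
box-crossing alike) — the property that lets FILE F4-A's per-bond lemma run on ONE index set `δ : Fin d → Fin 2` with every root below both ends of the bond.

CONTENTS (ns `…Theorems.Prop7TentWeightsZd`): §1 the one-dimensional tent (`tent_nonneg`, `tent_le_one`, `tent_of_le` ∕ `tent_add_of_le` (closed forms on `[0,ℓ]` ∕ `[ℓ,2ℓ]`),
`tent_add_tent_add_eq_one`, `abs_tent_succ_sub_le`); §2 the tensor tent (`tensorTent_nonneg`, `tensorTent_le_one`, ★ `sum_tensorTent_shift_eq_one` (`Σ_δ Π_i t(q i + ℓδ i) = 1` for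
`0 ≤ q ≤ ℓ`), ★ `abs_tensorTent_succ_sub_le` (`ℓ⁻¹`-Lipschitz along every lattice direction)); §3 the box reading at `Y z := ⌊z∕ℓ⌋ = blockMap ℓ z` (`offset_mem` : `z − ℓ·⌊z∕ℓ⌋ ∈ [0,ℓ)^d`, `root_le`, `sub_root_le`,
`tentArg_eq`, ★★ `sum_tensorTent_boxes_eq_one`, ★★ `sum_tensorTent_boxes_succ_eq_one`); §4 support and re-indexing (`tent_eq_zero_of`, `arg_mem_of_tensorTent_ne_zero`,
★ `exists_offset_of_tensorTent_ne_zero`, `boxesBelow_injective`, ★★ `sum_boxesBelow_eq_of_support`); at the member `ℓ = Lᵏ` and `(blockMap L)^[k] = blockMap (Lᵏ)` (px5 g6's ✓`iterate_blockMap_eq`).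
HONEST SCOPE.  Arithmetic; no estimate of print; rung R3, not Clay; YM gap NOT proved.

References: T. Bałaban, CMP **98** (1985) 17–51 [Balaban1985Averaging] ((2) p.17, (43) p.24 — the block letters); CMP **99** (1985) 389–434 [Balaban1985BackgroundPropagators] ((3.19) p.393).
-/

set_option autoImplicit false

noncomputable section

open scoped BigOperators

namespace Summit.QuantumFields.YangMills.Theorems.Prop7TentWeightsZd

open Literature.MathematicalPhysics.QuantumFieldTheory.Balaban1983to89
open Literature.MathematicalPhysics.QuantumLattice (blockMap blockBase blockSites mem_blockSites_iff)
open B7Prop1Explicit renaming Site → LSite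
open B7Prop1Explicit (e e_apply)

/-! ## §1 The one-dimensional tent `t(q) = max 0 (1 − |q − ℓ|∕ℓ)` -/

section OneDim

variable {ℓ : ℕ}

/-- `0 ≤ t(q)`. [folklore] -/
theorem tent_nonneg (ℓ : ℕ) (q : ℤ) : 0 ≤ max 0 (1 - |(q : ℝ) - ℓ| / ℓ) := le_max_left _ _

/-- `t(q) ≤ 1`. [folklore] -/
theorem tent_le_one (ℓ : ℕ) (q : ℤ) : max 0 (1 - |(q : ℝ) - ℓ| / ℓ) ≤ 1 :=
  max_le zero_le_one (sub_le_self _ (by positivity))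

/-- On `[0, ℓ]`: `t(q) = q∕ℓ`. [folklore] -/
theorem tent_of_le (hℓ : 0 < ℓ) {q : ℤ} (h0 : 0 ≤ q) (h1 : q ≤ ℓ) : max 0 (1 - |(q : ℝ) - ℓ| / ℓ) = (q : ℝ) / ℓ := by
  have hℓr : (0 : ℝ) < ℓ := by exact_mod_cast hℓ
  have hq0 : (0 : ℝ) ≤ q := by exact_mod_cast h0
  have hq1 : (q : ℝ) ≤ ℓ := by exact_mod_cast h1
  have hval : 1 - |(q : ℝ) - ℓ| / ℓ = (q : ℝ) / ℓ := by
    rw [abs_of_nonpos (by linarith)]; field_simp; ring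
  rw [hval, max_eq_right (by positivity)]

/-- On `[ℓ, 2ℓ]`: `t(ℓ + q) = (ℓ − q)∕ℓ` for `q ∈ [0, ℓ]`. [folklore] -/
theorem tent_add_of_le (hℓ : 0 < ℓ) {q : ℤ} (h0 : 0 ≤ q) (h1 : q ≤ ℓ) : max 0 (1 - |((q + ℓ : ℤ) : ℝ) - ℓ| / ℓ) = ((ℓ : ℝ) - q) / ℓ := by
  have hℓr : (0 : ℝ) < ℓ := by exact_mod_cast hℓ
  have hq0 : (0 : ℝ) ≤ q := by exact_mod_cast h0
  have hq1 : (q : ℝ) ≤ ℓ := by exact_mod_cast h1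
  have hval : 1 - |((q + ℓ : ℤ) : ℝ) - ℓ| / ℓ = ((ℓ : ℝ) - q) / ℓ := by
    push_cast
    rw [add_sub_cancel_right, abs_of_nonneg hq0]; field_simp
  have hnn : 0 ≤ ((ℓ : ℝ) - q) / ℓ := div_nonneg (by linarith) hℓr.le
  rw [hval, max_eq_right hnn]

/-- The two tents alive at a point of `[0, ℓ]` add up to `1`: `t(q) + t(q + ℓ) = 1`. [folklore] -/
theorem tent_add_tent_add_eq_one (hℓ : 0 < ℓ) {q : ℤ} (h0 : 0 ≤ q) (h1 : q ≤ ℓ) :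
    max 0 (1 - |(q : ℝ) - ℓ| / ℓ) + max 0 (1 - |((q + ℓ : ℤ) : ℝ) - ℓ| / ℓ) = 1 := by
  have hℓr : (0 : ℝ) < ℓ := by exact_mod_cast hℓ
  rw [tent_of_le hℓ h0 h1, tent_add_of_le hℓ h0 h1]
  field_simp; ring

/-- `t` is `ℓ⁻¹`-Lipschitz on `ℤ`: `|t(q + 1) − t(q)| ≤ ℓ⁻¹`. [folklore] -/
theorem abs_tent_succ_sub_le (hℓ : 0 < ℓ) (q : ℤ) :
    |max 0 (1 - |((q + 1 : ℤ) : ℝ) - ℓ| / ℓ) - max 0 (1 - |(q : ℝ) - ℓ| / ℓ)| ≤ (ℓ : ℝ)⁻¹ := by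
  have hℓr : (0 : ℝ) < ℓ := by exact_mod_cast hℓ
  -- `max 0` is 1-Lipschitz, `1 − |·|∕ℓ` is `ℓ⁻¹`-Lipschitz
  have h1 : |(1 - |((q + 1 : ℤ) : ℝ) - ℓ| / ℓ) - (1 - |(q : ℝ) - ℓ| / ℓ)| ≤ (ℓ : ℝ)⁻¹ := by
    rw [show (1 - |((q + 1 : ℤ) : ℝ) - ℓ| / ℓ) - (1 - |(q : ℝ) - ℓ| / ℓ) = (|(q : ℝ) - ℓ| - |((q + 1 : ℤ) : ℝ) - ℓ|) / ℓ by ring,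
      abs_div, abs_of_pos hℓr, div_le_iff₀ hℓr, inv_mul_cancel₀ hℓr.ne']
    have := abs_abs_sub_abs_le ((q : ℝ) - ℓ) (((q + 1 : ℤ) : ℝ) - ℓ)
    push_cast at this ⊢
    rw [show (q : ℝ) - ℓ - (q + 1 - ℓ) = -1 by ring, abs_neg, abs_one] at this
    exact this
  rw [max_comm (0:ℝ), max_comm (0:ℝ)]
  exact (abs_max_sub_max_le_abs _ _ _).trans h1

end OneDim

/-! ## §2 The tensor tent -/

section Tensor

variable {d : ℕ}

/-- `0 ≤ Θ`. [folklore] -/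
theorem tensorTent_nonneg (ℓ : ℕ) (q : LSite d) : 0 ≤ ∏ i, max 0 (1 - |(q i : ℝ) - ℓ| / ℓ) :=
  Finset.prod_nonneg fun i _ => tent_nonneg ℓ (q i)

/-- `Θ ≤ 1`. [folklore] -/
theorem tensorTent_le_one (ℓ : ℕ) (q : LSite d) : ∏ i, max 0 (1 - |(q i : ℝ) - ℓ| / ℓ) ≤ 1 :=
  Finset.prod_le_one (fun i _ => tent_nonneg ℓ (q i)) fun i _ => tent_le_one ℓ (q i)

/-- ★ **PARTITION OF UNITY**: for `q ∈ [0, ℓ]^d`, `Σ_{δ ∈ {0,1}^d} Π_i t(q i + ℓ·δ i) = 1` (expand `Π_i (t(q i) + t(q i + ℓ))`). [folklore] -/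
theorem sum_tensorTent_shift_eq_one {ℓ : ℕ} (hℓ : 0 < ℓ) (q : LSite d) (h0 : ∀ i, 0 ≤ q i) (h1 : ∀ i, q i ≤ ℓ) :
    ∑ δ : Fin d → Fin 2, ∏ i, max 0 (1 - |((q i + ℓ * ((δ i : ℕ) : ℤ) : ℤ) : ℝ) - ℓ| / ℓ) = 1 := by
  rw [← Fintype.prod_sum (fun i (j : Fin 2) => max 0 (1 - |((q i + ℓ * ((j : ℕ) : ℤ) : ℤ) : ℝ) - ℓ| / ℓ))]
  refine Finset.prod_eq_one fun i _ => ?_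
  rw [Fin.sum_univ_two]
  simp only [Fin.val_zero, Nat.cast_zero, mul_zero, add_zero, Fin.val_one, Nat.cast_one, mul_one]
  exact tent_add_tent_add_eq_one hℓ (h0 i) (h1 i)

/-- ★ **`ℓ⁻¹`-LIPSCHITZ ALONG A LATTICE DIRECTION**: `|Θ(q + e_μ) − Θ(q)| ≤ ℓ⁻¹` (one factor moves by `≤ ℓ⁻¹`, the others lie in `[0,1]`). [folklore] -/
theorem abs_tensorTent_succ_sub_le {ℓ : ℕ} (hℓ : 0 < ℓ) (q : LSite d) (μ : Fin d) :
    |(∏ i, max 0 (1 - |((q + e μ) i : ℝ) - ℓ| / ℓ)) - ∏ i, max 0 (1 - |(q i : ℝ) - ℓ| / ℓ)| ≤ (ℓ : ℝ)⁻¹ := by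
  rw [← Finset.mul_prod_erase Finset.univ _ (Finset.mem_univ μ), ← Finset.mul_prod_erase Finset.univ (fun i => max 0 (1 - |(q i : ℝ) - ℓ| / ℓ)) (Finset.mem_univ μ)]
  have hsame : ∏ i ∈ Finset.univ.erase μ, max 0 (1 - |((q + e μ) i : ℝ) - ℓ| / ℓ) = ∏ i ∈ Finset.univ.erase μ, max 0 (1 - |(q i : ℝ) - ℓ| / ℓ) :=
    Finset.prod_congr rfl fun i hi => by rw [Pi.add_apply, e_apply, if_neg (Finset.ne_of_mem_erase hi), add_zero]
  rw [hsame, ← sub_mul, abs_mul]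
  have hP0 : 0 ≤ ∏ i ∈ Finset.univ.erase μ, max 0 (1 - |(q i : ℝ) - ℓ| / ℓ) := Finset.prod_nonneg fun i _ => tent_nonneg ℓ (q i)
  have hP1 : ∏ i ∈ Finset.univ.erase μ, max 0 (1 - |(q i : ℝ) - ℓ| / ℓ) ≤ 1 := Finset.prod_le_one (fun i _ => tent_nonneg ℓ (q i)) fun i _ => tent_le_one ℓ (q i)
  rw [abs_of_nonneg hP0]
  have hμ : ((q + e μ) μ : ℝ) = ((q μ + 1 : ℤ) : ℝ) := by rw [Pi.add_apply, e_apply, if_pos rfl]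
  rw [hμ]
  calc _ ≤ (ℓ : ℝ)⁻¹ * 1 := mul_le_mul (abs_tent_succ_sub_le hℓ (q μ)) hP1 hP0 (by positivity)
    _ = _ := mul_one _

end Tensor

/-! ## §3 Reading the weights on the `ℓ`-boxes of `ℤᵈ` (`Y z := ⌊z∕ℓ⌋ = blockMap ℓ z`; at the member `ℓ = Lᵏ` and `(blockMap L)^[k] = blockMap (Lᵏ)`) -/

section Boxes

variable {d : ℕ}

/-- **THE OFFSET OF A FINE SITE IN ITS `ℓ`-BOX LIES IN `[0, ℓ)^d`**: `0 ≤ z i − ℓ·⌊z∕ℓ⌋ i < ℓ`. [cite: Balaban1985Averaging, (2) p.17, (43) p.24] -/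
theorem offset_mem {ℓ : ℕ} (hℓ : 0 < ℓ) (z : LSite d) (i : Fin d) :
    0 ≤ z i - (ℓ : ℤ) * (blockMap ℓ z) i ∧ z i - (ℓ : ℤ) * (blockMap ℓ z) i < ℓ := by
  have hℓ' : (0 : ℤ) < (ℓ : ℤ) := by exact_mod_cast hℓ
  simp only [blockMap]
  constructor
  · have := Int.emod_nonneg (z i) hℓ'.ne'
    rw [Int.emod_def] at this; linarith
  · have := Int.emod_lt_of_pos (z i) hℓ'
    rw [Int.emod_def] at this; linarith

/-- **EVERY ROOT IS BELOW THE SITE**: `ℓ·(⌊z∕ℓ⌋ − δ) ≤ z` coordinatewise, `δ ∈ {0,1}^d`. [cite: Balaban1985Averaging, (43) p.24] -/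
theorem root_le {ℓ : ℕ} (hℓ : 0 < ℓ) (z : LSite d) (δ : Fin d → Fin 2) :
    blockBase ℓ (blockMap ℓ z - fun i => ((δ i : ℕ) : ℤ)) ≤ z := by
  intro i
  have h := (offset_mem hℓ z i).1
  simp only [blockBase, Pi.sub_apply]
  have hδ : (0 : ℤ) ≤ (ℓ : ℤ) * ((δ i : ℕ) : ℤ) := by positivity
  linarith

/-- … and the site is less than `2ℓ` above it: `z i − ℓ·(⌊z∕ℓ⌋ − δ) i ≤ 2ℓ − 1`. [cite: Balaban1985Averaging, (43) p.24] -/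
theorem sub_root_le {ℓ : ℕ} (hℓ : 0 < ℓ) (z : LSite d) (δ : Fin d → Fin 2) (i : Fin d) :
    z i - blockBase ℓ (blockMap ℓ z - fun i => ((δ i : ℕ) : ℤ)) i ≤ 2 * (ℓ : ℤ) - 1 := by
  have h := (offset_mem hℓ z i).2
  have hδ : ((δ i : ℕ) : ℤ) ≤ 1 := by have := (δ i).isLt; omega
  simp only [blockBase, Pi.sub_apply, mul_sub]
  have hℓ0 : (0 : ℤ) ≤ (ℓ : ℤ) := by positivity
  nlinarith

/-- The argument of the tent of root `⌊z∕ℓ⌋ − δ` at `z` is `offset + ℓδ`. [folklore] -/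
theorem tentArg_eq (ℓ : ℕ) (z : LSite d) (δ : Fin d → Fin 2) (i : Fin d) :
    z i - (ℓ : ℤ) * ((blockMap ℓ z - fun i => ((δ i : ℕ) : ℤ)) i)
      = (z i - (ℓ : ℤ) * (blockMap ℓ z) i) + (ℓ : ℤ) * ((δ i : ℕ) : ℤ) := by
  simp only [Pi.sub_apply]; ring

/-- ★★ **THE `2^d` BOXES BELOW A SITE CARRY ALL THE WEIGHT**: `Σ_{δ ∈ {0,1}^d} Θ(⌊z∕ℓ⌋ − δ, z) = 1`. [cite: Balaban1985Averaging, (43) p.24; folklore] -/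
theorem sum_tensorTent_boxes_eq_one {ℓ : ℕ} (hℓ : 0 < ℓ) (z : LSite d) :
    ∑ δ : Fin d → Fin 2, ∏ i, max 0 (1 - |((z i - (ℓ : ℤ) * ((blockMap ℓ z - fun i => ((δ i : ℕ) : ℤ)) i) : ℤ) : ℝ) - ℓ| / ℓ) = 1 := by
  simp only [tentArg_eq]
  exact sum_tensorTent_shift_eq_one hℓ _ (fun i => (offset_mem hℓ z i).1) (fun i => (offset_mem hℓ z i).2.le)

/-- ★★ **… AND STILL AT THE NEXT SITE ALONG ANY DIRECTION** (in-box or box-crossing alike): `Σ_{δ ∈ {0,1}^d} Θ(⌊z∕ℓ⌋ − δ, z + e_μ) = 1`. [cite: Balaban1985Averaging, (43) p.24; folklore] -/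
theorem sum_tensorTent_boxes_succ_eq_one {ℓ : ℕ} (hℓ : 0 < ℓ) (z : LSite d) (μ : Fin d) :
    ∑ δ : Fin d → Fin 2, ∏ i, max 0 (1 - |((((z + e μ) i - (ℓ : ℤ) * ((blockMap ℓ z - fun i => ((δ i : ℕ) : ℤ)) i)) : ℤ) : ℝ) - ℓ| / ℓ) = 1 := by
  have harg : ∀ (δ : Fin d → Fin 2) (i : Fin d), (z + e μ) i - (ℓ : ℤ) * ((blockMap ℓ z - fun i => ((δ i : ℕ) : ℤ)) i)
      = ((z i - (ℓ : ℤ) * (blockMap ℓ z) i) + e μ i) + (ℓ : ℤ) * ((δ i : ℕ) : ℤ) := by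
    intro δ i; simp only [Pi.add_apply, Pi.sub_apply]; ring
  simp only [harg]
  refine sum_tensorTent_shift_eq_one hℓ (fun i => (z i - (ℓ : ℤ) * (blockMap ℓ z) i) + e μ i) (fun i => ?_) (fun i => ?_)
  · have := (offset_mem hℓ z i).1
    rw [e_apply]; split_ifs <;> linarith
  · have := (offset_mem hℓ z i).2
    rw [e_apply]; split_ifs <;> linarith

end Boxes

/-! ## §4 Support and re-indexing: the boxes weighted at `z` or at `z + e_μ` are among the `2^d` boxes below `z` -/

section Support

variable {d : ℕ}

/-- Off `(0, 2ℓ)` the tent vanishes. [folklore] -/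
theorem tent_eq_zero_of {ℓ : ℕ} (hℓ : 0 < ℓ) {q : ℤ} (h : q ≤ 0 ∨ 2 * (ℓ : ℤ) ≤ q) : max 0 (1 - |(q : ℝ) - ℓ| / ℓ) = 0 := by
  have hℓr : (0 : ℝ) < ℓ := by exact_mod_cast hℓ
  refine max_eq_left ?_
  rw [sub_nonpos, le_div_iff₀ hℓr, one_mul]
  rcases h with h | h
  · have : (q : ℝ) ≤ 0 := by exact_mod_cast h
    rw [abs_of_nonpos (by linarith)]; linarith
  · have : 2 * (ℓ : ℝ) ≤ q := by exact_mod_cast h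
    rw [abs_of_nonneg (by linarith)]; linarith

/-- A non-vanishing tensor tent pins every coordinate of its argument into `(0, 2ℓ)`. [folklore] -/
theorem arg_mem_of_tensorTent_ne_zero {ℓ : ℕ} (hℓ : 0 < ℓ) {q : LSite d} (h : ∏ i, max 0 (1 - |(q i : ℝ) - ℓ| / ℓ) ≠ 0) (i : Fin d) :
    0 < q i ∧ q i < 2 * (ℓ : ℤ) := by
  have hi : max 0 (1 - |(q i : ℝ) - ℓ| / ℓ) ≠ 0 := fun h0 => h (Finset.prod_eq_zero (Finset.mem_univ i) h0)
  by_contra hc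
  exact hi (tent_eq_zero_of hℓ (by omega))

/-- ★ **THE BOXES WEIGHTED AT `z + e_μ` (OR AT `z`) ARE AMONG THE `2^d` BOXES `⌊z∕ℓ⌋ − δ` BELOW `z`**: if `Θ(Y′, z + v) ≠ 0` with `0 ≤ v ≤ 1` coordinatewise then `Y′ = ⌊z∕ℓ⌋ − δ` for some
`δ ∈ {0,1}^d`. [cite: Balaban1985Averaging, (43) p.24; folklore] -/
theorem exists_offset_of_tensorTent_ne_zero {ℓ : ℕ} (hℓ : 0 < ℓ) (z v Y' : LSite d) (hv0 : ∀ i, 0 ≤ v i) (hv1 : ∀ i, v i ≤ 1)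
    (h : ∏ i, max 0 (1 - |(((z + v) i - (ℓ : ℤ) * Y' i : ℤ) : ℝ) - ℓ| / ℓ) ≠ 0) :
    ∃ δ : Fin d → Fin 2, Y' = blockMap ℓ z - fun i => ((δ i : ℕ) : ℤ) := by
  have hℓ' : (0 : ℤ) < ℓ := by exact_mod_cast hℓ
  have hco : ∀ i, Y' i = (blockMap ℓ z) i ∨ Y' i = (blockMap ℓ z) i - 1 := by
    intro i
    have hq := arg_mem_of_tensorTent_ne_zero hℓ h i
    simp only [Pi.add_apply] at hq
    have h0 := (offset_mem hℓ z i).1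
    have h1 := (offset_mem hℓ z i).2
    have hv0i := hv0 i
    have hv1i := hv1 i
    -- `ℓ Y' i ≤ z i` and `ℓ Y' i ≥ z i + 1 - 2ℓ`, while `ℓ ⌊z∕ℓ⌋ i ≤ z i < ℓ ⌊z∕ℓ⌋ i + ℓ`
    have hup : Y' i ≤ blockMap ℓ z i := by
      by_contra hc
      have : blockMap ℓ z i + 1 ≤ Y' i := by omega
      nlinarith
    have hlo : blockMap ℓ z i - 1 ≤ Y' i := by
      by_contra hc
      have : Y' i ≤ blockMap ℓ z i - 2 := by omega
      nlinarith
    omega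
  refine ⟨fun i => if Y' i = blockMap ℓ z i then 0 else 1, funext fun i => ?_⟩
  simp only [Pi.sub_apply]
  rcases hco i with hc | hc
  · rw [if_pos hc]; simp [hc]
  · have hne : Y' i ≠ blockMap ℓ z i := by rw [hc]; omega
    rw [if_neg hne]; simp [hc]

/-- The `2^d` boxes below `z`, as an injective family. [folklore] -/
theorem boxesBelow_injective (ℓ : ℕ) (z : LSite d) :
    Function.Injective (fun δ : Fin d → Fin 2 => blockMap ℓ z - fun i => ((δ i : ℕ) : ℤ)) := by
  intro δ δ' h
  funext i
  have hi := congrFun h i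
  simp only [Pi.sub_apply, sub_right_inj, Nat.cast_inj] at hi
  exact Fin.ext hi

/-- ★★ **RE-INDEXING**: a function of the coarse sites that vanishes off the boxes below `z` AND off the boxes below `z′` has the same sum over either family — used with `z′ = z + e_μ`
for the far end of a box-crossing bond. [folklore] -/
theorem sum_boxesBelow_eq_of_support {M : Type*} [AddCommMonoid M] (ℓ : ℕ) (z z' : LSite d) (φ : LSite d → M)
    (hz : ∀ Y', φ Y' ≠ 0 → ∃ δ : Fin d → Fin 2, Y' = blockMap ℓ z - fun i => ((δ i : ℕ) : ℤ))
    (hz' : ∀ Y', φ Y' ≠ 0 → ∃ δ : Fin d → Fin 2, Y' = blockMap ℓ z' - fun i => ((δ i : ℕ) : ℤ)) :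
    ∑ δ : Fin d → Fin 2, φ (blockMap ℓ z' - fun i => ((δ i : ℕ) : ℤ)) = ∑ δ : Fin d → Fin 2, φ (blockMap ℓ z - fun i => ((δ i : ℕ) : ℤ)) := by
  classical
  set A : Finset (LSite d) := Finset.univ.image (fun δ : Fin d → Fin 2 => blockMap ℓ z - fun i => ((δ i : ℕ) : ℤ)) with hA
  set A' : Finset (LSite d) := Finset.univ.image (fun δ : Fin d → Fin 2 => blockMap ℓ z' - fun i => ((δ i : ℕ) : ℤ)) with hA'
  have hsum : ∀ (w : LSite d) (B : Finset (LSite d)),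
      (∀ Y', φ Y' ≠ 0 → ∃ δ : Fin d → Fin 2, Y' = blockMap ℓ w - fun i => ((δ i : ℕ) : ℤ)) →
      Finset.univ.image (fun δ : Fin d → Fin 2 => blockMap ℓ w - fun i => ((δ i : ℕ) : ℤ)) ⊆ B →
      ∑ δ : Fin d → Fin 2, φ (blockMap ℓ w - fun i => ((δ i : ℕ) : ℤ)) = ∑ Y' ∈ B, φ Y' := by
    intro w B hw hB
    rw [← Finset.sum_image (fun δ _ δ' _ h => boxesBelow_injective ℓ w h)]
    refine Finset.sum_subset hB fun Y' _ hY' => ?_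
    by_contra hne
    obtain ⟨δ, rfl⟩ := hw Y' hne
    exact hY' (Finset.mem_image.2 ⟨δ, Finset.mem_univ _, rfl⟩)
  rw [hsum z' (A ∪ A') hz' Finset.subset_union_right, hsum z (A ∪ A') hz Finset.subset_union_left]

end Support

end Summit.QuantumFields.YangMills.Theorems.Prop7TentWeightsZd

end
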